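import Literature.AlgebraicGeometry.Motives.HodgeStructureOrientationOfGaloisDegree
import Mathlib.NumberTheory.Cyclotomic.Gal
import HarnessLib

/-!
# The cyclotomic field `ℚ(ζ₁₃)`: an effective `4`-orientation `Π` with `𝓡(Π) = 5 < 7 = 𝓡(Θ^G_Π)`; with `ℚ(ζ₂₄)`
# (`CyclotomicFieldTwentyFourOrientation.lean`) Green–Griffiths–Kerr's Question (V.A.10) fails for oriented CM fields in
# every weight `n ≥ 3`

[topic AlgebraicGeometry/Motives]

Lane `lit-hodgefound` (seat `lit-hodgefound-p02`, gen 26, row g26-#9).  The group-level weight-`4` counterexample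
`CounterexampleVA10.Weight4` of `Literature/NumberTheory/ComplexMultiplication/OrientedTypeRankPrimeDegree.lean` lives on
`ℤ/12`; here it is read on `ℚ(ζ₁₃)` (GGK's own example field of (V.A.5) (iii)–(v)): §1 a GENERAL lemma — for any cyclotomic CM
field `K = ℚ(ζ_m)`, `m > 2`, complex conjugation is `σ_{−1}` under Mathlib's `IsCyclotomicExtension.autEquivPow`
(`autEquivPow_conjGal_eq_neg_one`); §2 the discrete logarithm `(ℤ/13)^× ≃* ℤ/12` to base `2` (`unitsEquiv13`, `−1 ↦ 6`, checked by
`decide`), `galEquiv13 : Gal(ℚ(ζ₁₃)/ℚ) ≃* G12` with `ρ ↦ ρ12`; §3 the unconditional statement **`exists_orientation_kubotaRank_lt_weight_four`**: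
on `ℚ(ζ₁₃)` there is an effective `4`-orientation `Π` with `Π^{2,2} = ∅` and its G-type `Θ = [4 < 2 deg_Π] ∈ Θ(Π)` with
`𝓡(ℚ(ζ₁₃),Π) = 5 < 7 = 𝓡(ℚ(ζ₁₃),Θ) = ½[ℚ(ζ₁₃):ℚ] + 1` (`Θ` strongly nondegenerate, `Π` not).

HONEST SCOPE.  As in the `ℚ(ζ₂₄)` file: `IsGalois`/`IsCMField` of `ℚ(ζ₁₃)` are Mathlib theorems used through private lemmas and
`haveI`; no `instance` is declared; §1 takes `[IsCMField K]` as an instance argument.  In GGK's notation `θ_a : ζ₁₃ ↦ e^{2πia/13}`: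
`Π^{0,4} = {θ₁,θ₂}`, `Π^{1,3} = {θ₄,θ₇,θ₈,θ₁₀}`, `Π^{3,1} = {θ₃,θ₅,θ₆,θ₉}`, `Π^{4,0} = {θ₁₁,θ₁₂}` (up to the base embedding).

## References
* [GreenGriffithsKerr2012] M. Green, P. Griffiths, M. Kerr, *Mumford–Tate Groups and Domains: Their Geometry and
  Arithmetic*, Ann. of Math. Stud. 183, Princeton UP (2012): (V.A.4)–(V.A.5) pp. 156–157 (`θ_i = θ₁σ_i` on `ℚ(ζ_m)`), (V.A.10) p. 158.
-/

noncomputable section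

open scoped Pointwise

open NumberField Module

namespace Literature.AlgebraicGeometry.Motives

namespace HodgeStructure

namespace Orientation

open Literature.NumberTheory.ComplexMultiplication Literature.NumberTheory.ComplexMultiplication.CounterexampleVA10
  Literature.NumberTheory.ComplexMultiplication.CounterexampleVA10.Weight4

/-! ## §1 Complex conjugation of a cyclotomic CM field is `σ_{−1}` -/

/-- **For `K = ℚ(ζ_m)` (`m > 2`, `K` CM) complex conjugation is `σ_{−1} : ζ ↦ ζ⁻¹`**, i.e. Mathlib's `autEquivPow` sends
`conjGal` to `−1 ∈ (ℤ/m)^×` (`ι(ρζ) = conj(ιζ) = (ιζ)⁻¹` as `|ιζ| = 1`). [cite: GreenGriffithsKerr2012, (V.A.4) p. 156 («θ_j^{-1} = θ_{j⁻¹}»)] -/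
theorem autEquivPow_conjGal_eq_neg_one {m : ℕ} [NeZero m] (hm : 2 < m) (K : Type) [Field K] [NumberField K]
    [IsCyclotomicExtension {m} ℚ K] [IsCMField K] (h : Irreducible (Polynomial.cyclotomic m ℚ)) :
    IsCyclotomicExtension.autEquivPow K h (conjGal : K ≃ₐ[ℚ] K) = -1 := by
  have hζ := IsCyclotomicExtension.zeta_spec m ℚ K
  obtain ⟨ι⟩ : Nonempty (K →+* ℂ) := inferInstance
  have hm1 : m - 1 + 1 = m := Nat.sub_add_cancel (by omega)
  -- `ρ ζ = ζ⁻¹ = ζ^{m−1}`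
  have hconj : (conjGal : K ≃ₐ[ℚ] K) (IsCyclotomicExtension.zeta m ℚ K) = (IsCyclotomicExtension.zeta m ℚ K)⁻¹ := by
    apply ι.injective
    rw [conjGal_apply, IsCMField.complexEmbedding_complexConj, map_inv₀]
    have h1 : ‖ι (IsCyclotomicExtension.zeta m ℚ K)‖ = 1 := by
      have hp : (ι (IsCyclotomicExtension.zeta m ℚ K)) ^ m = 1 := by rw [← map_pow, hζ.pow_eq_one, map_one]
      exact Complex.norm_eq_one_of_pow_eq_one hp (NeZero.ne m)
    exact (Complex.inv_eq_conj h1).symm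
  have hinv : (IsCyclotomicExtension.zeta m ℚ K)⁻¹ = IsCyclotomicExtension.zeta m ℚ K ^ (m - 1) := by
    have hp : IsCyclotomicExtension.zeta m ℚ K ^ (m - 1) * IsCyclotomicExtension.zeta m ℚ K = 1 := by
      rw [← pow_succ, hm1, hζ.pow_eq_one]
    exact (eq_inv_of_mul_eq_one_left hp).symm
  have hspec := hζ.autToPow_spec ℚ (conjGal : K ≃ₐ[ℚ] K)
  rw [hconj, hinv] at hspec
  have hval : ((hζ.autToPow ℚ (conjGal : K ≃ₐ[ℚ] K) : (ZMod m)ˣ) : ZMod m).val = m - 1 :=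
    hζ.pow_inj (ZMod.val_lt _) (by omega) hspec
  have htz : ((hζ.autToPow ℚ (conjGal : K ≃ₐ[ℚ] K) : (ZMod m)ˣ) : ZMod m) = ((-1 : (ZMod m)ˣ) : ZMod m) := by
    rw [Units.val_neg, Units.val_one, ← ZMod.natCast_zmod_val ((hζ.autToPow ℚ (conjGal : K ≃ₐ[ℚ] K) : (ZMod m)ˣ) : ZMod m),
      hval, Nat.cast_sub (by omega : 1 ≤ m), ZMod.natCast_self, Nat.cast_one, zero_sub]
  rw [IsCyclotomicExtension.autEquivPow_apply]
  exact Units.ext htz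

/-! ## §2 `Gal(ℚ(ζ₁₃)/ℚ) ≅ (ℤ/13)^× ≃* ℤ/12` (discrete logarithm to base `2`), `ρ ↦ 6` -/

/-- The discrete logarithm to base `2` modulo `13`, as a map `ℤ/13 → G12 = Multiplicative (ℤ/12)` (`2^i ↦ i`; value at `0`
irrelevant). [cite: GreenGriffithsKerr2012, (V.A.5) p. 157] -/
def logMap13 (x : ZMod 13) : G12 :=
  match x.val with
  | 1 => e12 0
  | 2 => e12 1
  | 4 => e12 2
  | 8 => e12 3
  | 3 => e12 4
  | 6 => e12 5
  | 12 => e12 6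
  | 11 => e12 7
  | 9 => e12 8
  | 5 => e12 9
  | 10 => e12 10
  | _ => e12 11

/-- `log(xy) = log x + log y` on non-zero residues (a finite check). [folklore] -/
private theorem logMap13_mul : ∀ x y : ZMod 13, x ≠ 0 → y ≠ 0 → logMap13 (x * y) = logMap13 x * logMap13 y := by
  decide

/-- `log` is injective on non-zero residues (a finite check). [folklore] -/
private theorem logMap13_injOn : ∀ x y : ZMod 13, x ≠ 0 → y ≠ 0 → logMap13 x = logMap13 y → x = y := by
  decide

/-- `log 1 = 0`. [folklore] -/
private theorem logMap13_one : logMap13 1 = 1 := by decide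

/-- `log(−1) = 6`: `−1 = 2⁶ (mod 13)`. [folklore] -/
private theorem logMap13_neg_one : logMap13 (-1) = ρ12 := by decide

/-- The discrete logarithm on `(ℤ/13)^×` as a group homomorphism. [cite: GreenGriffithsKerr2012, (V.A.5) p. 157] -/
def unitsHom13 : (ZMod 13)ˣ →* G12 where
  toFun u := logMap13 (u : ZMod 13)
  map_one' := by rw [Units.val_one, logMap13_one]
  map_mul' u v := by
    haveI : Fact (1 < 13) := ⟨by norm_num⟩
    rw [Units.val_mul]
    exact logMap13_mul _ _ u.ne_zero v.ne_zero

/-- Unfolding. [folklore] -/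
private theorem unitsHom13_apply (u : (ZMod 13)ˣ) : unitsHom13 u = logMap13 (u : ZMod 13) := rfl

/-- `unitsHom13` is bijective (`|(ℤ/13)^×| = φ(13) = 12`). [cite: GreenGriffithsKerr2012, (V.A.5) p. 157] -/
theorem unitsHom13_bijective : Function.Bijective unitsHom13 := by
  haveI : Fact (Nat.Prime 13) := ⟨by norm_num⟩
  haveI : Fact (1 < 13) := ⟨by norm_num⟩
  have hinj : Function.Injective unitsHom13 := fun u v huv =>
    Units.ext (logMap13_injOn _ _ u.ne_zero v.ne_zero huv)
  refine (Fintype.bijective_iff_injective_and_card _).2 ⟨hinj, ?_⟩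
  rw [ZMod.card_units_eq_totient, card_G12]
  decide

/-- **`(ℤ/13)^× ≃* ℤ/12`** (discrete logarithm). [cite: GreenGriffithsKerr2012, (V.A.5) p. 157] -/
def unitsEquiv13 : (ZMod 13)ˣ ≃* G12 := MulEquiv.ofBijective unitsHom13 unitsHom13_bijective

/-- **`unitsEquiv13 (−1) = ρ12`** (`= 6 ∈ ℤ/12`). [cite: GreenGriffithsKerr2012, (V.A.5) p. 157] -/
theorem unitsEquiv13_neg_one : unitsEquiv13 (-1) = ρ12 := by
  rw [unitsEquiv13, MulEquiv.ofBijective_apply, unitsHom13_apply, Units.val_neg, Units.val_one]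
  exact logMap13_neg_one

/-- `ℚ(ζ₁₃)`. [cite: GreenGriffithsKerr2012, (V.A.5) p. 157] -/
abbrev K13 : Type := CyclotomicField 13 ℚ

/-- `Φ₁₃` is irreducible over `ℚ`. [folklore] -/
private theorem irreducible_cyclotomic13 : Irreducible (Polynomial.cyclotomic 13 ℚ) :=
  Polynomial.cyclotomic.irreducible_rat (by norm_num)

/-- `ℚ(ζ₁₃)` is the `13`-th cyclotomic extension of `ℚ` (named instance term). [folklore] -/
private theorem isCyclotomicExtension_K13 : IsCyclotomicExtension {13} ℚ K13 := CyclotomicField.isCyclotomicExtension 13 ℚ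

/-- `ℚ(ζ₁₃)/ℚ` is Galois. [folklore] -/
private theorem isGalois_K13 : IsGalois ℚ K13 :=
  haveI := isCyclotomicExtension_K13
  IsCyclotomicExtension.isGalois {13} ℚ K13

/-- `ℚ(ζ₁₃)` is a CM field. [folklore] -/
private theorem isCMField_K13 : IsCMField K13 :=
  @IsCyclotomicExtension.Rat.isCMField K13 _ _ {13} ⟨13, Set.mem_singleton 13, by norm_num⟩ isCyclotomicExtension_K13

/-- **`Gal(ℚ(ζ₁₃)/ℚ) ≃* ℤ/12`** (`σ_{2^i} ↦ i`). [cite: GreenGriffithsKerr2012, (V.A.5) p. 157] -/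
def galEquiv13 : (K13 ≃ₐ[ℚ] K13) ≃* G12 :=
  haveI := isCyclotomicExtension_K13
  (IsCyclotomicExtension.autEquivPow K13 irreducible_cyclotomic13).trans unitsEquiv13

/-- **Complex conjugation `↦ ρ12 = 6`.** [cite: GreenGriffithsKerr2012, (V.A.5) p. 157] -/
theorem galEquiv13_conjGal [IsCMField K13] : galEquiv13 (conjGal : K13 ≃ₐ[ℚ] K13) = ρ12 := by
  haveI := isCyclotomicExtension_K13
  show ((IsCyclotomicExtension.autEquivPow K13 irreducible_cyclotomic13).trans unitsEquiv13) conjGal = ρ12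
  rw [MulEquiv.trans_apply, autEquivPow_conjGal_eq_neg_one (by norm_num) K13 irreducible_cyclotomic13, unitsEquiv13_neg_one]

/-! ## §3 The unconditional weight-`4` statement on `ℚ(ζ₁₃)` -/

/-- `[ℚ(ζ₁₃):ℚ] = 12`. [cite: GreenGriffithsKerr2012, (V.A.5) p. 157] -/
theorem finrank_K13 : Module.finrank ℚ K13 = 12 := by
  haveI := isGalois_K13
  rw [← IsGalois.card_aut_eq_finrank, Nat.card_eq_fintype_card, Fintype.card_congr galEquiv13.toEquiv, card_G12]

/-- **QUESTION (V.A.10) FAILS IN WEIGHT `4` ON `ℚ(ζ₁₃)`**: there are an effective `4`-orientation `Λ` of `ℚ(ζ₁₃)` with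
`Λ^{2,2} = ∅` and its G-type `Θ` (`deg_Θ = [4 < 2·deg_Λ]`, `Θ ∈ Θ(Λ)`) with `𝓡(ℚ(ζ₁₃),Λ) = 5 < 7 = 𝓡(ℚ(ζ₁₃),Θ)`; `Θ` is strongly
nondegenerate (`7 = ½·12 + 1`) and `Λ` is not. [cite: GreenGriffithsKerr2012, (V.A.10) p. 158] -/
theorem exists_orientation_kubotaRank_lt_weight_four (ι : K13 →+* ℂ) :
    ∃ (Λ : Orientation K13 4) (Θ : Orientation K13 1),
      (∀ θ, 0 ≤ Λ.deg θ ∧ Λ.deg θ ≤ 4 ∧ Λ.deg θ ≠ 2) ∧ (∀ θ, Θ.deg θ = if 4 < 2 * Λ.deg θ then 1 else 0) ∧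
        Λ.kubotaRank (AlgHom.id ℚ K13) ι = 5 ∧ Θ.kubotaRank (AlgHom.id ℚ K13) ι = 7 ∧
          Λ.kubotaRank (AlgHom.id ℚ K13) ι < Θ.kubotaRank (AlgHom.id ℚ K13) ι ∧
            Θ.IsStronglyNondegenerate (AlgHom.id ℚ K13) ι ∧ ¬Λ.IsStronglyNondegenerate (AlgHom.id ℚ K13) ι := by
  haveI := isGalois_K13
  haveI := isCMField_K13
  have hpρ : ∀ g : K13 ≃ₐ[ℚ] K13, (p12 ∘ galEquiv13) ((conjGal : K13 ≃ₐ[ℚ] K13) * g) = 4 - (p12 ∘ galEquiv13) g := by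
    intro g
    simp only [Function.comp_apply, map_mul, galEquiv13_conjGal]
    exact isOrientedTypeWith_p12.deg_rho (galEquiv13 g)
  have htρ : ∀ g : K13 ≃ₐ[ℚ] K13, (t12 ∘ galEquiv13) ((conjGal : K13 ≃ₐ[ℚ] K13) * g) = 1 - (t12 ∘ galEquiv13) g := by
    intro g
    simp only [Function.comp_apply, map_mul, galEquiv13_conjGal]
    exact isOrientedTypeWith_t12.deg_rho (galEquiv13 g)
  have h5 : (ofGaloisDeg ι (p12 ∘ galEquiv13) hpρ).kubotaRank (AlgHom.id ℚ K13) ι = 5 := by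
    rw [kubotaRank_ofGaloisDeg, degRank_comp_mulEquiv, degRank_p12]
  have h7 : (ofGaloisDeg ι (t12 ∘ galEquiv13) htρ).kubotaRank (AlgHom.id ℚ K13) ι = 7 := by
    rw [kubotaRank_ofGaloisDeg, degRank_comp_mulEquiv, degRank_t12]
  refine ⟨ofGaloisDeg ι (p12 ∘ galEquiv13) hpρ, ofGaloisDeg ι (t12 ∘ galEquiv13) htρ, fun θ => p12_effective _, fun θ => rfl,
    h5, h7, by rw [h5, h7]; norm_num, ?_, ?_⟩
  · rw [isStronglyNondegenerate_iff, h7, finrank_K13]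
  · rw [isStronglyNondegenerate_iff, h5, finrank_K13]
    norm_num

end Orientation

end HodgeStructure

end Literature.AlgebraicGeometry.Motives
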